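import Summits.ResolutionOfSingularities.ResolutionOfSingularities.Theorems.FrobeniusLadderFInjectiveMacaulayficationTauFloorOneCIChartDomain
import Literature.AlgebraicGeometry.Resolution.AffineBlowupAlgebra
import HarnessLib

/-!
# F4POS-1 (d-C): the CI chart ring IS the Rees chart `D(ȳ)` of `Bl_τ(P2d4C)`: `C ≃+* A₀[τ/ȳ] = blowupAlgebra τ ȳ`
# (crux `FInjectiveMacaulayfication` stmt-ResolutionOfSingularities-15315, chain w45a; res-L1-w45a-plan-1 R18.17 (b)/R18.18 «F4POS-1 (d): … the missing Rees-chart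
# identification»; seat res-L1-w45a-stub-1 g10)

[OURS · L1 W4.5a] Support file (`--supports stmt-ResolutionOfSingularities-15315 --as helper`); def-free, unconditional; replaces the role of NO printed item;
NOT a statement of the manuscript; AI-written (AI review is weaker than expert review).

`A₀ = k[X₀..X₄]/(f)` (P2d4C, char 2), `τ = (x̄², ȳ, ū, t̄, z̄)` (res-L1-w45a-stub-3's p618085 spelling `Ideal.span {mk X₀ ^ 2, mk X₁, mk X₂, mk X₃, mk X₄}`),
`C = k[X₀..X₅]/(x² − wy, z′² + y(1 + w²z′ + u′³ + t′³))`. The chart map `φ : C → A₀[1/ȳ]` of `…TauFloorOneCIChartDomain` (injective, p619693) has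
range EXACTLY the affine blow-up algebra `A₀[τ/ȳ] = blowupAlgebra τ ȳ ⊆ A₀[1/ȳ]` (Görtz–Wedhorn (13.19)): `⊆` on generators (`x̄²/ȳ, ū/ȳ, t̄/ȳ, z̄/ȳ` are
`g/ȳ` with `g ∈ τ`; `x̄, ȳ ∈ A₀`), `⊇` because the range is an `A₀`-subalgebra (`φ ∘ ψ₁ = algebraMap`, `ψ₁` the blow-down map) containing `g/ȳ` for every `g ∈ τ`.
★★ `exists_chartEquiv : ∃ e : C ≃+* blowupAlgebra τ ȳ, ∀ j, (e (mk (X j)) : A₀[1/ȳ]) = (x, y, x²/y, u/y, t/y, z/y)ⱼ`; consequences: `isDomain_blowupAlgebra` (again),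
and every structural fact of `C` (CM clause p617990, non-FULL locus p617516) transports to the chart ring of `Bl_τ X`. (`D(ū)`, `D(t̄)` by the symmetry `y ↔ u ↔ t`.)
[cite: GortzWedhorn2020, (13.19) p. 415; StacksProject, Tag 0804]
-/

-- single-problem summit: the doubled namespace component is forced
set_option linter.dupNamespace false

noncomputable section

namespace Summit.ResolutionOfSingularities.ResolutionOfSingularities.Theorems.FInjectiveMacaulayfication.TauFloorOneCIChartIdent

open MvPolynomial IsLocalization Literature.AlgebraicGeometry.Resolution
open Summit.ResolutionOfSingularities.ResolutionOfSingularities.Theorems.FInjectiveMacaulayfication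
open TauFloorOneCIChartCore TauFloorOneCIChartDomain

variable (k : Type) [Field k]

set_option synthInstance.maxHeartbeats 200000 in
set_option maxHeartbeats 1600000 in
-- instance search on `Localization.Away` over the quotient ring is slow (as in `…TauFloorOneCIChartDomain`)
/-- ★★ **The CI chart ring is the Rees chart `D(ȳ)` of `Bl_τ X`**: a ring isomorphism `C ≃+* blowupAlgebra τ ȳ` over `A₀[1/ȳ]` sending
`x, y, w, u′, t′, z′ ↦ x, y, x²/y, u/y, t/y, z/y`. [cite: GortzWedhorn2020, (13.19)] -/
theorem exists_chartEquiv (f : MvPolynomial (Fin 5) k) (hf : f = X 4 ^ 2 + X 0 ^ 4 * X 4 + X 1 ^ 3 + X 2 ^ 3 + X 3 ^ 3)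
    (g₁ g₂ : MvPolynomial (Fin 6) k) (hg₁ : g₁ = X 0 ^ 2 - X 2 * X 1) (hg₂ : g₂ = X 5 ^ 2 + X 1 * (1 + X 2 ^ 2 * X 5 + X 3 ^ 3 + X 4 ^ 3)) :
    ∃ e : (MvPolynomial (Fin 6) k ⧸ Ideal.span {g₁, g₂}) ≃+*
        blowupAlgebra (Ideal.span {Ideal.Quotient.mk (Ideal.span {f}) (X 0) ^ 2, Ideal.Quotient.mk (Ideal.span {f}) (X 1),
          Ideal.Quotient.mk (Ideal.span {f}) (X 2), Ideal.Quotient.mk (Ideal.span {f}) (X 3), Ideal.Quotient.mk (Ideal.span {f}) (X 4)} :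
            Ideal (MvPolynomial (Fin 5) k ⧸ Ideal.span {f}))
          (Ideal.Quotient.mk (Ideal.span {f}) (X 1)),
      ∀ j : Fin 6, ((e (Ideal.Quotient.mk (Ideal.span {g₁, g₂}) (X j)) :
          blowupAlgebra _ (Ideal.Quotient.mk (Ideal.span {f}) (X 1))) :
            Localization.Away (Ideal.Quotient.mk (Ideal.span {f}) (X 1) : MvPolynomial (Fin 5) k ⧸ Ideal.span {f})) =
        ![algebraMap (MvPolynomial (Fin 5) k ⧸ Ideal.span {f}) (Localization.Away (Ideal.Quotient.mk (Ideal.span {f}) (X 1) :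
              MvPolynomial (Fin 5) k ⧸ Ideal.span {f})) (Ideal.Quotient.mk (Ideal.span {f}) (X 0)),
          algebraMap (MvPolynomial (Fin 5) k ⧸ Ideal.span {f}) (Localization.Away (Ideal.Quotient.mk (Ideal.span {f}) (X 1) :
              MvPolynomial (Fin 5) k ⧸ Ideal.span {f})) (Ideal.Quotient.mk (Ideal.span {f}) (X 1)),
          algebraMap (MvPolynomial (Fin 5) k ⧸ Ideal.span {f}) (Localization.Away (Ideal.Quotient.mk (Ideal.span {f}) (X 1) :
              MvPolynomial (Fin 5) k ⧸ Ideal.span {f})) (Ideal.Quotient.mk (Ideal.span {f}) (X 0)) ^ 2 * Away.invSelf (Ideal.Quotient.mk (Ideal.span {f}) (X 1)),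
          algebraMap (MvPolynomial (Fin 5) k ⧸ Ideal.span {f}) (Localization.Away (Ideal.Quotient.mk (Ideal.span {f}) (X 1) :
              MvPolynomial (Fin 5) k ⧸ Ideal.span {f})) (Ideal.Quotient.mk (Ideal.span {f}) (X 2)) * Away.invSelf (Ideal.Quotient.mk (Ideal.span {f}) (X 1)),
          algebraMap (MvPolynomial (Fin 5) k ⧸ Ideal.span {f}) (Localization.Away (Ideal.Quotient.mk (Ideal.span {f}) (X 1) :
              MvPolynomial (Fin 5) k ⧸ Ideal.span {f})) (Ideal.Quotient.mk (Ideal.span {f}) (X 3)) * Away.invSelf (Ideal.Quotient.mk (Ideal.span {f}) (X 1)),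
          algebraMap (MvPolynomial (Fin 5) k ⧸ Ideal.span {f}) (Localization.Away (Ideal.Quotient.mk (Ideal.span {f}) (X 1) :
              MvPolynomial (Fin 5) k ⧸ Ideal.span {f})) (Ideal.Quotient.mk (Ideal.span {f}) (X 4)) * Away.invSelf (Ideal.Quotient.mk (Ideal.span {f}) (X 1))] j := by
  classical
  obtain ⟨φ, hφX, hφC⟩ := exists_chartMap k f hf g₁ g₂ hg₁ hg₂
  have hinj := chartMap_injective k f hf g₁ g₂ hg₁ hg₂ φ hφX hφC
  obtain ⟨ψ₁, hψX, hψC⟩ := exists_blowdownMap k f hf g₁ g₂ hg₁ hg₂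
  -- abbreviations (terms only)
  let mkA : MvPolynomial (Fin 5) k →+* MvPolynomial (Fin 5) k ⧸ Ideal.span {f} := Ideal.Quotient.mk (Ideal.span {f})
  let mkC : MvPolynomial (Fin 6) k →+* MvPolynomial (Fin 6) k ⧸ Ideal.span {g₁, g₂} := Ideal.Quotient.mk (Ideal.span {g₁, g₂})
  let τ : Ideal (MvPolynomial (Fin 5) k ⧸ Ideal.span {f}) := Ideal.span {mkA (X 0) ^ 2, mkA (X 1), mkA (X 2), mkA (X 3), mkA (X 4)}
  let B : Subalgebra (MvPolynomial (Fin 5) k ⧸ Ideal.span {f}) (Localization.Away (mkA (X 1))) := blowupAlgebra τ (mkA (X 1))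
  let ι : (MvPolynomial (Fin 5) k ⧸ Ideal.span {f}) →+* Localization.Away (mkA (X 1)) := algebraMap _ _
  have hyi : ι (mkA (X 1)) * Away.invSelf (mkA (X 1)) = 1 := Away.mul_invSelf _
  -- (1) `φ ∘ ψ₁ = algebraMap A₀ A₀[1/ȳ]`
  have hφψ : φ.comp ψ₁ = ι := by
    refine Ideal.Quotient.ringHom_ext (MvPolynomial.ringHom_ext (fun a => ?_) (fun j => ?_))
    · change φ (ψ₁ (mkA (C a))) = ι (mkA (C a))
      rw [hψC, hφC]
    · change φ (ψ₁ (mkA (X j))) = ι (mkA (X j))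
      rw [hψX]
      fin_cases j
      · exact hφX 0
      · exact hφX 1
      · change φ (mkC (X 3) * mkC (X 1)) = ι (mkA (X 2))
        rw [map_mul, hφX 3, hφX 1]
        change ι (mkA (X 2)) * Away.invSelf (mkA (X 1)) * ι (mkA (X 1)) = ι (mkA (X 2))
        rw [mul_assoc, mul_comm (Away.invSelf _), hyi, mul_one]
      · change φ (mkC (X 4) * mkC (X 1)) = ι (mkA (X 3))
        rw [map_mul, hφX 4, hφX 1]
        change ι (mkA (X 3)) * Away.invSelf (mkA (X 1)) * ι (mkA (X 1)) = ι (mkA (X 3))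
        rw [mul_assoc, mul_comm (Away.invSelf _), hyi, mul_one]
      · change φ (mkC (X 5) * mkC (X 1)) = ι (mkA (X 4))
        rw [map_mul, hφX 5, hφX 1]
        change ι (mkA (X 4)) * Away.invSelf (mkA (X 1)) * ι (mkA (X 1)) = ι (mkA (X 4))
        rw [mul_assoc, mul_comm (Away.invSelf _), hyi, mul_one]
  have hι_mem : ∀ a, ι a ∈ φ.range := fun a => ⟨ψ₁ a, by rw [← RingHom.comp_apply, hφψ]⟩
  -- (2) `range φ ⊆ B`: generators
  have hX_mem : ∀ j : Fin 6, φ (mkC (X j)) ∈ B := by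
    intro j
    rw [hφX]
    fin_cases j
    · exact B.algebraMap_mem (mkA (X 0))
    · exact B.algebraMap_mem (mkA (X 1))
    · change ι (mkA (X 0)) ^ 2 * Away.invSelf (mkA (X 1)) ∈ B
      rw [← map_pow]
      exact div_mem_blowupAlgebra τ (mkA (X 1)) (Ideal.subset_span (by simp))
    · change ι (mkA (X 2)) * Away.invSelf (mkA (X 1)) ∈ B
      exact div_mem_blowupAlgebra τ (mkA (X 1)) (Ideal.subset_span (by simp))
    · change ι (mkA (X 3)) * Away.invSelf (mkA (X 1)) ∈ B
      exact div_mem_blowupAlgebra τ (mkA (X 1)) (Ideal.subset_span (by simp))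
    · change ι (mkA (X 4)) * Away.invSelf (mkA (X 1)) ∈ B
      exact div_mem_blowupAlgebra τ (mkA (X 1)) (Ideal.subset_span (by simp))
  have hrange_le : ∀ c, φ c ∈ B := by
    intro c
    obtain ⟨q, rfl⟩ := Ideal.Quotient.mk_surjective c
    induction q using MvPolynomial.induction_on with
    | C a => change φ (mkC (C a)) ∈ B; rw [hφC]; exact B.algebraMap_mem _
    | add p q hp hq => rw [map_add, map_add]; exact B.add_mem hp hq
    | mul_X p j hp => rw [map_mul, map_mul]; exact B.mul_mem hp (hX_mem j)
  -- (3) `B ⊆ range φ`: the range is an `A₀`-subalgebra containing the generators `g/ȳ`, `g ∈ τ`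
  let Rφ : Subalgebra (MvPolynomial (Fin 5) k ⧸ Ideal.span {f}) (Localization.Away (mkA (X 1))) :=
    { carrier := φ.range
      mul_mem' := fun ha hb => φ.range.mul_mem ha hb
      one_mem' := φ.range.one_mem
      add_mem' := fun ha hb => φ.range.add_mem ha hb
      zero_mem' := φ.range.zero_mem
      algebraMap_mem' := fun a => hι_mem a }
  have hgens : blowupAlgebraGens τ (mkA (X 1)) ⊆ (Rφ : Set (Localization.Away (mkA (X 1)))) := by
    rintro _ ⟨g, hg, rfl⟩
    change ι g * Away.invSelf (mkA (X 1)) ∈ φ.range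
    refine Submodule.span_induction (p := fun g _ => ι g * Away.invSelf (mkA (X 1)) ∈ φ.range) ?_ ?_ ?_ ?_ hg
    · intro g hg
      simp only [Set.mem_insert_iff, Set.mem_singleton_iff] at hg
      rcases hg with rfl | rfl | rfl | rfl | rfl
      · exact ⟨mkC (X 2), by rw [hφX, map_pow]; rfl⟩
      · exact ⟨1, by rw [map_one, hyi]⟩
      · exact ⟨mkC (X 3), hφX 3⟩
      · exact ⟨mkC (X 4), hφX 4⟩
      · exact ⟨mkC (X 5), hφX 5⟩
    · rw [map_zero, zero_mul]; exact φ.range.zero_mem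
    · intro a b _ _ ha hb
      rw [map_add, add_mul]; exact φ.range.add_mem ha hb
    · intro r a _ ha
      rw [smul_eq_mul, map_mul, mul_assoc]; exact φ.range.mul_mem (hι_mem r) ha
  have hle_range : B ≤ Rφ := Algebra.adjoin_le hgens
  -- (4) the equivalence
  have hsurj : Function.Surjective (φ.codRestrict B.toSubring fun c => hrange_le c) := by
    intro b
    obtain ⟨c, hc⟩ := (hle_range b.2 : (b : Localization.Away (mkA (X 1))) ∈ φ.range)
    exact ⟨c, Subtype.ext hc⟩
  have hinj' : Function.Injective (φ.codRestrict B.toSubring fun c => hrange_le c) := fun a b h =>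
    hinj (congrArg Subtype.val h)
  refine ⟨RingEquiv.ofBijective (φ.codRestrict B.toSubring fun c => hrange_le c) ⟨hinj', hsurj⟩, fun j => ?_⟩
  exact hφX j

/-- Hence the Rees chart ring `A₀[τ/ȳ]` is an integral domain (transport of `TauFloorOneCIChartDomain.isDomain`; also directly a subring of `A₀[1/ȳ]`).
[folklore] -/
theorem isDomain_blowupAlgebra [CharP k 2] (f : MvPolynomial (Fin 5) k) (hf : f = X 4 ^ 2 + X 0 ^ 4 * X 4 + X 1 ^ 3 + X 2 ^ 3 + X 3 ^ 3) :
    IsDomain (blowupAlgebra (Ideal.span {Ideal.Quotient.mk (Ideal.span {f}) (X 0) ^ 2, Ideal.Quotient.mk (Ideal.span {f}) (X 1),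
      Ideal.Quotient.mk (Ideal.span {f}) (X 2), Ideal.Quotient.mk (Ideal.span {f}) (X 3), Ideal.Quotient.mk (Ideal.span {f}) (X 4)} :
        Ideal (MvPolynomial (Fin 5) k ⧸ Ideal.span {f})) (Ideal.Quotient.mk (Ideal.span {f}) (X 1))) := by
  haveI := TauFloorOneCIChartDomain.isDomain k f hf (X 0 ^ 2 - X 2 * X 1) (X 5 ^ 2 + X 1 * (1 + X 2 ^ 2 * X 5 + X 3 ^ 3 + X 4 ^ 3)) rfl rfl
  obtain ⟨e, -⟩ := exists_chartEquiv k f hf _ _ rfl rfl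
  exact MulEquiv.isDomain _ e.symm.toMulEquiv

end Summit.ResolutionOfSingularities.ResolutionOfSingularities.Theorems.FInjectiveMacaulayfication.TauFloorOneCIChartIdent

end
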